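import Summits.ResolutionOfSingularities.ResolutionOfSingularities.Theorems.PurelyInseparableDim4ResConeTwoSlotDivisibilityPow
import Summits.ResolutionOfSingularities.ResolutionOfSingularities.Theorems.PurelyInseparableDim4TschirnhausFrame
import HarnessLib
import HarnessLib.Audit.Tags

/-!
# Purely inseparable four-folds — THE SECOND TSCHIRNHAUS KEEPS THE `x_f`-FRAME: order, straight initial
# monomial and the dead `x_f`-rows survive `x_u ↦ x_u + ψ(x_λ, x_μ)` (cell `res-dim4-pi`, K2(p) lane, slice B;
# K24b-FRAME (E-u), bookkeeping half)

[OURS · counted 0 · cell `res-dim4-pi` · K2(p) lane holder res-dim4-p-12 g3 («typ-1 g3 takes (E-u)», bus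
2026-08-29 03:26:45Z: «composed AFTER p-1's β1 `exists_canonical_frame_state` so the straight cone + x_f-jet are
kept»); seat res-dim4-typ-1 g3.]  Nothing here proves K2(p)/K2(5), `NoIsolatedTrap 5 5` or resolution of
singularities in dimension ≥ 4 / characteristic `p` — NOT proved.  AI kernel work, weaker than expert review.

For a frame move `τ = FrameChange.tsch u ψ` with `ψ(0) = 0` and `u, f ∉ vars ψ` (the second Tschirnhaus of
`…ResConeCInfSecondTschirnhaus`, `ψ ∈ K[x_λ, x_μ]`, a linear part allowed):
* §1 `exists_of_mem_support_tsch` — SUPPORT TRANSPORT: every monomial `x^γ` of `τ P` comes from a monomial `x^β`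
  of `P` with the SAME `x_f`-exponent and `|β| ≤ |γ|` (`τ` fixes `x_f`, never creates `x_f`, never lowers degrees);
* §2 consequences, in the coefficient dress the window files read: `coeff_tsch_fRow_eq_zero` (a dead `x_f^j`-row
  below a degree bound stays dead — res-dim4-p-1 g4's β1 jet clause `n_f = 3, |n| ≤ N + 3`),
  `coeff_tsch_eq_zero_of_degree_lt` (order not lowered), `tsch_pairLedger` (res-dim4-p-3 g4's EXACT pair ledger
  «monomials of `x_f`-degree `≤ 3` are divisible by `x_λ x_μ`» is transported monomialwise), **`tsch_straight`**
  (`ord₀ = 4` with `in₄ = a·x_f⁴` is kept: `G − a x_f⁴ ∈ 𝔪₀⁵` is mapped into `𝔪₀⁵` and `x_f⁴` is fixed);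
* §3 adapters to res-dim4-p-2 g4's F2c window binders (support dress on `F = x^r·G`): `uRow_support_of_coeff`,
  `pairLedger_support_of_coeff`.
[cite: CossartPiltant2009, I.8.3.6] [folklore] bears_on: LADDER-RESOLUTION:D157-DOOR2 (res-dim4-pi · K2(p) · slice B
· K24b-FRAME (E-u)).  Supports stmt-ResolutionOfSingularities-16155 (helper).
-/

set_option linter.dupNamespace false -- mandated namespace of this single-conjunct summit

noncomputable section

namespace Summit.ResolutionOfSingularities.ResolutionOfSingularities.Theorems.PIDim4

namespace ResCone

open MvPolynomial Finset FrameChange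
open Literature.AlgebraicGeometry.Resolution

variable {K : Type} [Field K]

/-! ## 1. Support transport of `x_u ↦ x_u + ψ` -/

/-- `tsch u ψ (c·x^β) = c·x^{β − β_u e_u} · (x_u + ψ)^{β_u}`. [folklore] -/
theorem tsch_monomial_eq (u : Fin 4) (ψ : MvPolynomial (Fin 4) K) (β : Fin 4 →₀ ℕ) (c : K) :
    tsch u ψ (monomial β c) = monomial (β.erase u) c * (X u + ψ) ^ (β u) := by
  classical
  unfold tsch
  rw [aeval_monomial, algebraMap_eq, Finsupp.prod_fintype _ _ (fun i => pow_zero _),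
    ← Finset.mul_prod_erase Finset.univ _ (Finset.mem_univ u), if_pos rfl]
  have hrest : ∏ i ∈ Finset.univ.erase u, (if i = u then X u + ψ else (X i : MvPolynomial (Fin 4) K)) ^ β i =
      monomial (β.erase u) 1 := by
    rw [monomial_eq, C_1, one_mul, Finsupp.prod_fintype _ _ (fun i => pow_zero _),
      ← Finset.mul_prod_erase Finset.univ _ (Finset.mem_univ u), Finsupp.erase_same, pow_zero, one_mul]
    refine Finset.prod_congr rfl fun i hi => ?_
    have hiu : i ≠ u := Finset.ne_of_mem_erase hi
    rw [if_neg hiu, Finsupp.erase_ne hiu]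
  rw [hrest, monomial_eq, monomial_eq, C_1, one_mul]
  ring

/-- All monomials of `(x_u + ψ)^n` (`ψ(0) = 0`, `f ∉ vars ψ`, `f ≠ u`) are `x_f`-free of degree `≥ n`. [folklore] -/
theorem support_X_add_pow {u f : Fin 4} (huf : u ≠ f) {ψ : MvPolynomial (Fin 4) K} (hψ0 : constantCoeff ψ = 0)
    (hψf : f ∉ ψ.vars) (n : ℕ) {γ : Fin 4 →₀ ℕ} (hγ : γ ∈ ((X u + ψ) ^ n).support) :
    γ f = 0 ∧ n ≤ γ.degree := by
  classical
  refine ⟨?_, ?_⟩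
  · -- `f ∉ vars ((x_u + ψ)^n)`
    have hv : f ∉ ((X u + ψ) ^ n).vars := by
      intro h
      have h1 := MvPolynomial.vars_pow _ _ h
      rcases Finset.mem_union.mp (MvPolynomial.vars_add_subset _ _ h1) with h2 | h2
      · rw [MvPolynomial.vars_X] at h2
        exact huf.symm (Finset.mem_singleton.mp h2)
      · exact hψf h2
    exact (not_mem_vars_iff f _).mp hv γ hγ
  · -- `(x_u + ψ)^n ∈ 𝔪₀^n`
    have hm : (X u + ψ : MvPolynomial (Fin 4) K) ∈ originIdeal K := by
      rw [← pow_one (originIdeal K), IsolationCert.mem_originIdeal_pow_iff]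
      intro d hd
      have hd0 : d = 0 := (Finsupp.degree_eq_zero_iff d).mp (by omega)
      rw [hd0, coeff_add, ← constantCoeff_eq, constantCoeff_X, hψ0, add_zero]
    have hpow := (IsolationCert.mem_originIdeal_pow_iff n _).mp (Ideal.pow_mem_pow hm n)
    by_contra hlt
    exact (mem_support_iff.mp hγ) (hpow γ (by omega))

/-- **SUPPORT TRANSPORT**: every monomial `x^γ` of `tsch u ψ P` (`ψ(0) = 0`, `f ∉ vars ψ`, `f ≠ u`) comes from a
monomial `x^β` of `P` with `γ_f = β_f`, `|β| ≤ |γ|` and `β_i ≤ γ_i` for every `i ≠ u` (the move only multiplies by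
monomials in the other letters and lowers the `u`-exponent). [folklore] -/
theorem exists_of_mem_support_tsch {u f : Fin 4} (huf : u ≠ f) {ψ : MvPolynomial (Fin 4) K}
    (hψ0 : constantCoeff ψ = 0) (hψf : f ∉ ψ.vars) (P : MvPolynomial (Fin 4) K) {γ : Fin 4 →₀ ℕ}
    (hγ : γ ∈ (tsch u ψ P).support) :
    ∃ β ∈ P.support, γ f = β f ∧ β.degree ≤ γ.degree ∧ ∀ i, i ≠ u → β i ≤ γ i := by
  classical
  have hP : tsch u ψ P = ∑ β ∈ P.support, tsch u ψ (monomial β (coeff β P)) := by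
    conv_lhs => rw [P.as_sum]
    rw [map_sum]
  rw [hP] at hγ
  obtain ⟨β, hβ, hγβ⟩ := Finset.mem_biUnion.mp (Finset.mem_of_subset (support_sum) hγ)
  refine ⟨β, hβ, ?_⟩
  rw [tsch_monomial_eq, mem_support_iff, coeff_monomial_mul'] at hγβ
  by_cases hle : β.erase u ≤ γ
  · rw [if_pos hle] at hγβ
    have hγ' : γ - β.erase u ∈ ((X u + ψ) ^ (β u)).support := mem_support_iff.mpr (right_ne_zero_of_mul hγβ)
    obtain ⟨hf0, hdeg⟩ := support_X_add_pow huf hψ0 hψf (β u) hγ'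
    have hsplit : γ = β.erase u + (γ - β.erase u) := (add_tsub_cancel_of_le hle).symm
    have hdeg' : (β.erase u).degree + β u = β.degree := by
      have := Finsupp.erase_add_single u β
      have h := congrArg Finsupp.degree this
      rw [map_add, Finsupp.degree_single] at h
      exact h
    refine ⟨?_, ?_, fun i hiu => ?_⟩
    · have h := congrArg (fun g : Fin 4 →₀ ℕ => g f) hsplit
      simp only [Finsupp.add_apply, hf0, add_zero, Finsupp.erase_ne huf.symm] at h
      exact h
    · have h := congrArg Finsupp.degree hsplit
      rw [map_add] at h
      omega
    · have h := hle i
      rw [Finsupp.erase_ne hiu] at h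
      exact h
  · rw [if_neg hle] at hγβ
    exact absurd rfl hγβ

/-! ## 2. What the second Tschirnhaus keeps -/

/-- **A dead `x_f^j`-row below a degree bound stays dead**: if `coeff_n P = 0` for all `n_f = j`, `|n| ≤ B`,
then the same holds for `tsch u ψ P`. (β1's jet clause: `j = 3`, `B = N + 3`.) [OURS] [folklore] -/
theorem coeff_tsch_fRow_eq_zero {u f : Fin 4} (huf : u ≠ f) {ψ : MvPolynomial (Fin 4) K}
    (hψ0 : constantCoeff ψ = 0) (hψf : f ∉ ψ.vars) {P : MvPolynomial (Fin 4) K} {j B : ℕ}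
    (hP : ∀ n : Fin 4 →₀ ℕ, n f = j → n.degree ≤ B → coeff n P = 0) {n : Fin 4 →₀ ℕ} (hnf : n f = j)
    (hnB : n.degree ≤ B) : coeff n (tsch u ψ P) = 0 := by
  by_contra hne
  obtain ⟨β, hβ, hβf, hβdeg, -⟩ := exists_of_mem_support_tsch huf hψ0 hψf P (mem_support_iff.mpr hne)
  exact (mem_support_iff.mp hβ) (hP β (by rw [← hβf, hnf]) (hβdeg.trans hnB))

/-- **Degrees are not lowered**: if `P` has no monomial of degree `< o`, neither has `tsch u ψ P`. [folklore] -/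
theorem coeff_tsch_eq_zero_of_degree_lt {u f : Fin 4} (huf : u ≠ f) {ψ : MvPolynomial (Fin 4) K}
    (hψ0 : constantCoeff ψ = 0) (hψf : f ∉ ψ.vars) {P : MvPolynomial (Fin 4) K} {o : ℕ}
    (hP : ∀ n : Fin 4 →₀ ℕ, n.degree < o → coeff n P = 0) {n : Fin 4 →₀ ℕ} (hn : n.degree < o) :
    coeff n (tsch u ψ P) = 0 := by
  by_contra hne
  obtain ⟨β, hβ, -, hβdeg, -⟩ := exists_of_mem_support_tsch huf hψ0 hψf P (mem_support_iff.mpr hne)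
  exact (mem_support_iff.mp hβ) (hP β (lt_of_le_of_lt hβdeg hn))

/-- **THE EXACT PAIR LEDGER IS TRANSPORTED MONOMIALWISE** (res-dim4-p-3 g4's (B), bus 03:37:43Z): if every
monomial of `P` of `x_f`-degree `≤ 3` is divisible by `x_λ x_μ` (exponents `≥ e` at `λ` and at `μ`; `λ, μ ≠ u`),
then so is every monomial of `tsch u ψ P`. [OURS] [folklore] -/
theorem tsch_pairLedger {u f lam mu : Fin 4} (huf : u ≠ f) (hlu : lam ≠ u) (hmu : mu ≠ u)
    {ψ : MvPolynomial (Fin 4) K} (hψ0 : constantCoeff ψ = 0) (hψf : f ∉ ψ.vars) {P : MvPolynomial (Fin 4) K}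
    {e : ℕ} (hP : ∀ β ∈ P.support, β f ≤ 3 → e ≤ β lam ∧ e ≤ β mu) {γ : Fin 4 →₀ ℕ}
    (hγ : γ ∈ (tsch u ψ P).support) (hγf : γ f ≤ 3) : e ≤ γ lam ∧ e ≤ γ mu := by
  obtain ⟨β, hβ, hβf, -, hle⟩ := exists_of_mem_support_tsch huf hψ0 hψf P hγ
  obtain ⟨h1, h2⟩ := hP β hβ (by rw [← hβf]; exact hγf)
  exact ⟨h1.trans (hle lam hlu), h2.trans (hle mu hmu)⟩

/-- Coefficients of `a·x_f⁴`. [folklore] -/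
theorem coeff_C_mul_X_pow_four (f : Fin 4) (a : K) (n : Fin 4 →₀ ℕ) :
    coeff n (C a * X f ^ 4 : MvPolynomial (Fin 4) K) = if Finsupp.single f 4 = n then a else 0 := by
  rw [X_pow_eq_monomial, C_mul_monomial, mul_one, coeff_monomial]

/-- `ord₀ G = 4` with `in₄ G = a·x_f⁴`, in coefficients, means `G − a·x_f⁴ ∈ 𝔪₀⁵`. [folklore] -/
theorem sub_C_mul_X_pow_mem {f : Fin 4} {G : MvPolynomial (Fin 4) K} {a : K}
    (hlow : ∀ n : Fin 4 →₀ ℕ, n.degree < 4 → coeff n G = 0)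
    (h4 : ∀ n : Fin 4 →₀ ℕ, n.degree = 4 → coeff n G = if Finsupp.single f 4 = n then a else 0) :
    G - C a * X f ^ 4 ∈ originIdeal K ^ 5 := by
  rw [IsolationCert.mem_originIdeal_pow_iff]
  intro d hd
  rw [coeff_sub, coeff_C_mul_X_pow_four]
  rcases Nat.lt_or_ge d.degree 4 with h | h
  · rw [hlow d h, if_neg, sub_zero]
    intro heq
    rw [← heq, Finsupp.degree_single] at h
    exact lt_irrefl 4 h
  · rw [h4 d (by omega), sub_self]

/-- **THE STRAIGHT INITIAL MONOMIAL IS KEPT**: if `ord₀ G = 4` and `in₄ G = a·x_f⁴` (coefficient dress), the same holds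
for `tsch u ψ G` — `τ(G − a x_f⁴) ∈ 𝔪₀⁵` and `τ(x_f⁴) = x_f⁴`. [OURS] [cite: CossartPiltant2009, I.8.3.6] -/
theorem tsch_straight {u f : Fin 4} (huf : u ≠ f) {ψ : MvPolynomial (Fin 4) K} (hψ0 : constantCoeff ψ = 0)
    {G : MvPolynomial (Fin 4) K} {a : K} (hlow : ∀ n : Fin 4 →₀ ℕ, n.degree < 4 → coeff n G = 0)
    (h4 : ∀ n : Fin 4 →₀ ℕ, n.degree = 4 → coeff n G = if Finsupp.single f 4 = n then a else 0) :
    (∀ n : Fin 4 →₀ ℕ, n.degree < 4 → coeff n (tsch u ψ G) = 0) ∧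
      ∀ n : Fin 4 →₀ ℕ, n.degree = 4 → coeff n (tsch u ψ G) = if Finsupp.single f 4 = n then a else 0 := by
  have hτ0 : ∀ i, constantCoeff (tsch u ψ (X i)) = 0 := constantCoeff_tsch_X hψ0
  have hmem := map_mem_originIdeal_pow_of_origin (tsch u ψ) hτ0 (sub_C_mul_X_pow_mem hlow h4)
  rw [map_sub, map_mul, map_pow, tsch_X_of_ne ψ huf.symm, IsolationCert.mem_originIdeal_pow_iff] at hmem
  have hC : tsch u ψ (C a) = C a := by unfold tsch; rw [aeval_C, algebraMap_eq]
  rw [hC] at hmem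
  have key : ∀ n : Fin 4 →₀ ℕ, n.degree ≤ 4 →
      coeff n (tsch u ψ G) = if Finsupp.single f 4 = n then a else 0 := by
    intro n hn
    have h := hmem n (by omega)
    rw [coeff_sub, coeff_C_mul_X_pow_four, sub_eq_zero] at h
    exact h
  refine ⟨fun n hn => ?_, fun n hn => key n hn.le⟩
  rw [key n hn.le, if_neg]
  intro heq
  rw [← heq, Finsupp.degree_single] at hn
  exact lt_irrefl 4 hn

/-- The same in the `homogeneousComponent` dress of β1 (`exists_canonical_frame`): `ord₀`-part below `4` dead and
`homogeneousComponent 4 G = C a * X f ^ 4` are kept by `tsch u ψ`. [OURS] [cite: CossartPiltant2009, I.8.3.6] -/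
theorem tsch_straight_homogeneousComponent {u f : Fin 4} (huf : u ≠ f) {ψ : MvPolynomial (Fin 4) K}
    (hψ0 : constantCoeff ψ = 0) {G : MvPolynomial (Fin 4) K} {a : K}
    (hlow : ∀ n : Fin 4 →₀ ℕ, n.degree < 4 → coeff n G = 0) (h4 : homogeneousComponent 4 G = C a * X f ^ 4) :
    (∀ n : Fin 4 →₀ ℕ, n.degree < 4 → coeff n (tsch u ψ G) = 0) ∧
      homogeneousComponent 4 (tsch u ψ G) = C a * X f ^ 4 := by
  classical
  have h4' : ∀ n : Fin 4 →₀ ℕ, n.degree = 4 → coeff n G = if Finsupp.single f 4 = n then a else 0 := by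
    intro n hn
    have h := congrArg (coeff n) h4
    rw [coeff_homogeneousComponent, if_pos hn, coeff_C_mul_X_pow_four] at h
    exact h
  obtain ⟨hlow', h4τ⟩ := tsch_straight huf hψ0 hlow h4'
  refine ⟨hlow', ?_⟩
  ext n
  rw [coeff_homogeneousComponent, coeff_C_mul_X_pow_four]
  by_cases hn : n.degree = 4
  · rw [if_pos hn, h4τ n hn]
  · rw [if_neg hn, if_neg]
    intro hfn
    rw [← hfn, Finsupp.degree_single] at hn
    exact hn rfl


/-! ## 3. The window's support dress (res-dim4-p-2 g4's F2c binders) -/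

/-- **F2c's support dress of the dead `ū²`-row jet**: a coefficient statement «`coeff_m G = 0` for `m_u = 2`,
`m_f = 0`, `|m| < B`» on the residual becomes, on `F = x^r·G` (`r` free of `u, f`), the support statement
«no monomial `d` of `F` with `|d| < B + |r|` has `d_u = 2 ∧ d_f = 0`» (`…ResConeCInfFrameStep`'s `hrow`). [OURS] -/
theorem uRow_support_of_coeff {u f : Fin 4} {r : Fin 4 →₀ ℕ} (hru : r u = 0) (hrf : r f = 0)
    {G : MvPolynomial (Fin 4) K} {B : ℕ} (h : ∀ m : Fin 4 →₀ ℕ, m u = 2 → m f = 0 → m.degree < B → coeff m G = 0)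
    {d : Fin 4 →₀ ℕ} (hd : d ∈ (monomial r (1 : K) * G).support) (hdB : d.degree < B + r.degree) :
    ¬ (d u = 2 ∧ d f = 0) := by
  rintro ⟨hdu, hdf⟩
  rw [mem_support_iff, coeff_monomial_mul'] at hd
  split_ifs at hd with hle
  · rw [one_mul] at hd
    refine hd (h (d - r) ?_ ?_ ?_)
    · rw [Finsupp.tsub_apply, hru, hdu]
    · rw [Finsupp.tsub_apply, hrf, hdf]
    · have := congrArg Finsupp.degree (add_tsub_cancel_of_le hle)
      rw [map_add] at this
      omega
  · exact hd rfl

/-- **F2c's support dress of the ledger jet**: «`coeff_n G = 0` for `n_f ≤ 3`, `|n| < B`, `n_λ = 0 ∨ n_μ = 0`» on the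
residual becomes, on `F = x^r·G` with `r = x_λ x_μ`, «every monomial `d` of `F` with `d_f ≤ 3`, `|d| < B + 2` has
`d_λ, d_μ ≥ 2`» (`…ResConeCInfFrameStep`'s `hled`). [OURS] -/
theorem pairLedger_support_of_coeff {lam mu f : Fin 4} (hlm : lam ≠ mu) (hfl : f ≠ lam) (hfm : f ≠ mu)
    {G : MvPolynomial (Fin 4) K} {B : ℕ}
    (h : ∀ n : Fin 4 →₀ ℕ, n f ≤ 3 → n.degree < B → (n lam = 0 ∨ n mu = 0) → coeff n G = 0)
    {d : Fin 4 →₀ ℕ} (hd : d ∈ (monomial (Finsupp.single lam 1 + Finsupp.single mu 1) (1 : K) * G).support)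
    (hdf : d f ≤ 3) (hdB : d.degree < B + 2) : 2 ≤ d lam ∧ 2 ≤ d mu := by
  rw [mem_support_iff, coeff_monomial_mul'] at hd
  split_ifs at hd with hle
  · rw [one_mul] at hd
    set n := d - (Finsupp.single lam 1 + Finsupp.single mu 1) with hn
    have hsplit : d = Finsupp.single lam 1 + Finsupp.single mu 1 + n := (add_tsub_cancel_of_le hle).symm
    have hl : d lam = 1 + n lam := by
      have := congrArg (fun g : Fin 4 →₀ ℕ => g lam) hsplit
      simp only [Finsupp.add_apply, Finsupp.single_eq_same, Finsupp.single_eq_of_ne hlm] at this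
      omega
    have hm : d mu = 1 + n mu := by
      have := congrArg (fun g : Fin 4 →₀ ℕ => g mu) hsplit
      simp only [Finsupp.add_apply, Finsupp.single_eq_same, Finsupp.single_eq_of_ne hlm.symm] at this
      omega
    have hf : n f = d f := by
      have := congrArg (fun g : Fin 4 →₀ ℕ => g f) hsplit
      simp only [Finsupp.add_apply, Finsupp.single_eq_of_ne hfl, Finsupp.single_eq_of_ne hfm] at this
      omega
    have hdeg : n.degree + 2 = d.degree := by
      have := congrArg Finsupp.degree hsplit
      simp only [map_add, Finsupp.degree_single] at this
      omega
    by_contra hcon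
    refine hd (h n (by rw [hf]; exact hdf) (by omega) ?_)
    omega
  · exact absurd rfl hd

end ResCone

end Summit.ResolutionOfSingularities.ResolutionOfSingularities.Theorems.PIDim4

end
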